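import Literature.NumberTheory.Sieve.Maynard2016Lemma6Split
import Literature.NumberTheory.Sieve.Maynard2016Lemma6CountingProof
import Literature.NumberTheory.Sieve.Maynard2016CouplingSet
import Literature.NumberTheory.Sieve.Maynard2016CoupledBox

/-!
# Maynard (2016), Lemma 6: the main sum (6.7)/(6.8) as a combination of coupled sums

Trunk: AntSieve / parity (Maynard 2016 large-gaps ladder, named fact
`Literature.NumberTheory.Sieve.Maynard2016.Lemma6MainTerm` of `Maynard2016Lemma6Split.lean`).

J. Maynard, *Large gaps between primes*, Ann. of Math. 183 (2016) = arXiv:1408.5110, §6, displays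
(6.7)–(6.8): "We substitute the definition (eq:LambdaDef) of `λ_{d,e}` [(5.3)], expand the resulting
expression".  This file links the main multiplicative sum `Maynard2016.mainSum` (the real sum
`Σ'_{d,d',e,e'} λ_{d,e} λ_{d',e'} / [d,d',e,e']` over `[1,x]^{4k}` with the solvability conditions `Adm`)
to the coupled sums `LcmEuler.coupledLcmSum` of `Maynard2016CoupledBox.lean` (whose kernel
representation (6.10) is `LcmEuler.coupledLcmSum_eq_integral_freqKernel`), with the coupling sets
`Maynard2016.couplingSet` of `Maynard2016CouplingSet.lean`:
* `Maynard2016.adm_iff_coupledAdm` — on squarefree moduli the solvability condition `Adm` is the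
  coupled summation condition `LcmEuler.CoupledAdm (P_w) m M` (prime by prime);
* `Maynard2016.ofReal_mainSum_eq` — **(6.8) expanded**:
  `mainSum = Σ_j Σ_{j'} c_j c_{j'} · coupledLcmSum (P_w) m M (F_{·,j}) (F_{·,j'}) G G x y x`.

## References

* J. Maynard, *Large gaps between primes*, Ann. of Math. (2) 183 (2016), 915–933; arXiv:1408.5110,
  §5 display (5.3), §6 displays (6.7)–(6.8). [Maynard2016LargeGaps]
-/

noncomputable section

open Filter Finset
open scoped BigOperators Topology ArithmeticFunction.Moebius Classical

namespace Literature.NumberTheory.Sieve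

namespace Maynard2016

open LcmEuler

variable {k J : ℕ}

/-! ### `Adm` versus the coupled summation condition -/

/-- For a squarefree `g`, `(g : ℤ) ∣ N` iff every prime factor of `g` divides `N`. [folklore] -/
private theorem natCast_dvd_iff_forall_prime {g : ℕ} (hg : Squarefree g) (N : ℤ) :
    (g : ℤ) ∣ N ↔ ∀ p : ℕ, p.Prime → p ∣ g → (p : ℤ) ∣ N := by
  constructor
  · intro h p _ hpg
    exact (Int.natCast_dvd_natCast.2 hpg).trans h
  · intro h
    rw [← Nat.prod_primeFactors_of_squarefree hg]
    push_cast
    refine Finset.prod_dvd_of_coprime (fun p hp p' hp' hne => ?_) fun p hp => ?_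
    · show IsCoprime (p : ℤ) (p' : ℤ)
      rw [Int.isCoprime_iff_gcd_eq_one, Int.gcd_natCast_natCast]
      exact (Nat.coprime_primes (Nat.prime_of_mem_primeFactors hp)
        (Nat.prime_of_mem_primeFactors hp')).2 hne
    · exact h p (Nat.prime_of_mem_primeFactors hp) (Nat.dvd_of_mem_primeFactors hp)

/-- **`Adm` = the coupled summation condition**, when the `[d_i, d'_i]` are squarefree: the last
condition `([d_i,d'_i], [e_j,e'_j]) ∣ m q (h_j − h_i) − 1` is then equivalent to its prime-by-prime
form. [cite: Maynard2016LargeGaps, §6 display (6.8)] -/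
theorem adm_iff_coupledAdm {k x m q : ℕ} {d d' e e' : Fin k → ℕ}
    (hsq : ∀ i, Squarefree (Nat.lcm (d i) (d' i))) :
    Adm k x m q d d' e e' ↔ CoupledAdm (Pw x) m (couplingSet k x m q) (d, d') (e, e') := by
  unfold Adm CoupledAdm LcmCoprime
  simp only
  have hlast : (∀ i j : Fin k, ((Nat.gcd (Nat.lcm (d i) (d' i)) (Nat.lcm (e j) (e' j)) : ℕ) : ℤ) ∣
      (m : ℤ) * q * ((hTuple k x j : ℤ) - hTuple k x i) - 1) ↔
      ∀ p, p.Prime → ∀ i j, p ∣ Nat.lcm (d i) (d' i) → p ∣ Nat.lcm (e j) (e' j) →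
        (i, j) ∈ couplingSet k x m q p := by
    constructor
    · intro h p hp i j hpi hpj
      rw [mem_couplingSet]
      exact (natCast_dvd_iff_forall_prime ((hsq i).squarefree_of_dvd (Nat.gcd_dvd_left _ _)) _).1
        (h i j) p hp (Nat.dvd_gcd hpi hpj)
    · intro h i j
      refine (natCast_dvd_iff_forall_prime ((hsq i).squarefree_of_dvd (Nat.gcd_dvd_left _ _)) _).2
        fun p hp hpg => ?_
      rw [← mem_couplingSet]
      exact h p hp i j (hpg.trans (Nat.gcd_dvd_left _ _)) (hpg.trans (Nat.gcd_dvd_right _ _))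
  rw [hlast]
  tauto

/-! ### Expanding `λ_{d,e} λ_{d',e'}` -/

/-- `lcm` of squarefree naturals is squarefree. [folklore] -/
private theorem squarefree_lcm {a b : ℕ} (ha : Squarefree a) (hb : Squarefree b) :
    Squarefree (Nat.lcm a b) := by
  have ha0 : a ≠ 0 := ha.ne_zero
  have hb0 : b ≠ 0 := hb.ne_zero
  rw [Nat.squarefree_iff_factorization_le_one (Nat.lcm_ne_zero ha0 hb0)]
  intro p
  rw [Nat.factorization_lcm ha0 hb0]
  have h1 := (Nat.squarefree_iff_factorization_le_one ha0).1 ha p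
  have h2 := (Nat.squarefree_iff_factorization_le_one hb0).1 hb p
  simp only [Finsupp.sup_apply]
  exact sup_le h1 h2

/-- Rearranging the eight products of one `(j, j')`-term. [folklore] -/
private theorem prod_rearrange {ι : Type*} [Fintype ι] (c c' L : ℂ) (a₁ a₂ a₃ a₄ a₅ a₆ a₇ a₈ : ι → ℂ) :
    (∏ i, a₁ i * a₂ i) * (c * ∏ i, a₃ i * a₄ i) * ((∏ i, a₅ i * a₆ i) * (c' * ∏ i, a₇ i * a₈ i)) / L =
      c * c' * ((∏ i, a₁ i * a₅ i * a₃ i * a₇ i) * (∏ i, a₂ i * a₆ i * a₄ i * a₈ i) / L) := by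
  have h : (∏ i, a₁ i * a₂ i) * (∏ i, a₃ i * a₄ i) * ((∏ i, a₅ i * a₆ i) * ∏ i, a₇ i * a₈ i) =
      (∏ i, a₁ i * a₅ i * a₃ i * a₇ i) * ∏ i, a₂ i * a₆ i * a₄ i * a₈ i := by
    simp only [← Finset.prod_mul_distrib]
    exact Finset.prod_congr rfl fun i _ => by ring
  calc (∏ i, a₁ i * a₂ i) * (c * ∏ i, a₃ i * a₄ i) * ((∏ i, a₅ i * a₆ i) * (c' * ∏ i, a₇ i * a₈ i)) / L
      = c * c' * ((∏ i, a₁ i * a₂ i) * (∏ i, a₃ i * a₄ i) *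
          ((∏ i, a₅ i * a₆ i) * ∏ i, a₇ i * a₈ i) / L) := by ring
    _ = _ := by rw [h]

/-- **Substituting (5.3) and expanding**: `λ_{d,e} λ_{d',e'} / [d,d',e,e'] =
Σ_j Σ_{j'} c_j c_{j'} · coupledLcmTerm (F_{·,j}) (F_{·,j'}) G G x y (d,d') (e,e')`.
[cite: Maynard2016LargeGaps, §6 display (6.8)] -/
theorem ofReal_lam_mul_lam_div (c : Fin J → ℝ) (Fd : Fin k → Fin J → ℝ → ℝ) (G : ℝ → ℝ) (ε : ℝ)
    (x : ℕ) (d d' e e' : Fin k → ℕ) :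
    (lam c Fd G ε x d e : ℂ) * (lam c Fd G ε x d' e' : ℂ) /
        (Nat.lcm (∏ i, Nat.lcm (d i) (d' i)) (∏ i, Nat.lcm (e i) (e' i)) : ℂ) =
      ∑ j, ∑ j', (c j : ℂ) * c j' *
        coupledLcmTerm (fun ℓ => Fd ℓ j) (fun ℓ => Fd ℓ j') (fun _ : Fin k => G) (fun _ => G)
          (x : ℝ) (y ε x) (d, d') (e, e') := by
  rw [lam, lam]
  push_cast
  rw [Finset.mul_sum, Finset.mul_sum, Finset.sum_mul, Finset.sum_div]
  refine Finset.sum_congr rfl fun j _ => ?_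
  rw [Finset.mul_sum, Finset.sum_div]
  refine Finset.sum_congr rfl fun j' _ => ?_
  rw [coupledLcmTerm]
  exact prod_rearrange _ _ _ _ _ _ _ _ _ _ _

/-! ### The main sum as a combination of coupled sums -/

/-- The box `[1, X]^k` of `Maynard2016Lemma6Split` is the box `lcmBox (Fin k) X`. [folklore] -/
private theorem box_eq_lcmBox (k X : ℕ) : box k X = lcmBox (Fin k) X := rfl

/-- **(6.8), expanded**: the main multiplicative sum is the combination
`Σ_j Σ_{j'} c_j c_{j'} · coupledLcmSum (P_w) m M (F_{·,j}) (F_{·,j'}) G G x y x` of coupled sums over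
the box `[1,x]^{4k}` (the solvability conditions `Adm` and the coupled condition agree on the support
of `λ_{d,e} λ_{d',e'}`, where all moduli are squarefree). [cite: Maynard2016LargeGaps, §6 displays (6.7)–(6.8)] -/
theorem ofReal_mainSum_eq (c : Fin J → ℝ) (Fd : Fin k → Fin J → ℝ → ℝ) (G : ℝ → ℝ) (ε : ℝ)
    (x m q : ℕ) :
    ((mainSum c Fd G ε x m q : ℝ) : ℂ) =
      ∑ j, ∑ j', (c j : ℂ) * c j' *
        coupledLcmSum (Pw x) m (couplingSet k x m q) (fun ℓ => Fd ℓ j) (fun ℓ => Fd ℓ j')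
          (fun _ : Fin k => G) (fun _ => G) (x : ℝ) (y ε x) x := by
  -- the right-hand side as a single sum over the box
  have hrhs : ∑ j, ∑ j', (c j : ℂ) * c j' *
      coupledLcmSum (Pw x) m (couplingSet k x m q) (fun ℓ => Fd ℓ j) (fun ℓ => Fd ℓ j')
        (fun _ : Fin k => G) (fun _ => G) (x : ℝ) (y ε x) x =
      ∑ t ∈ (lcmBox (Fin k) x ×ˢ lcmBox (Fin k) x) ×ˢ (lcmBox (Fin k) x ×ˢ lcmBox (Fin k) x),
        if CoupledAdm (Pw x) m (couplingSet k x m q) t.1 t.2 then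
          ∑ j, ∑ j', (c j : ℂ) * c j' *
            coupledLcmTerm (fun ℓ => Fd ℓ j) (fun ℓ => Fd ℓ j') (fun _ : Fin k => G) (fun _ => G)
              (x : ℝ) (y ε x) t.1 t.2
        else 0 := by
    set B := (lcmBox (Fin k) x ×ˢ lcmBox (Fin k) x) ×ˢ (lcmBox (Fin k) x ×ˢ lcmBox (Fin k) x) with hB
    set T : Fin J → Fin J → ((Fin k → ℕ) × (Fin k → ℕ)) × ((Fin k → ℕ) × (Fin k → ℕ)) → ℂ :=
      fun j j' t => coupledLcmTerm (fun ℓ => Fd ℓ j) (fun ℓ => Fd ℓ j') (fun _ : Fin k => G)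
        (fun _ => G) (x : ℝ) (y ε x) t.1 t.2 with hT
    calc ∑ j, ∑ j', (c j : ℂ) * c j' *
          coupledLcmSum (Pw x) m (couplingSet k x m q) (fun ℓ => Fd ℓ j) (fun ℓ => Fd ℓ j')
            (fun _ : Fin k => G) (fun _ => G) (x : ℝ) (y ε x) x
        = ∑ j, ∑ j', ∑ t ∈ B, (c j : ℂ) * c j' *
            (if CoupledAdm (Pw x) m (couplingSet k x m q) t.1 t.2 then T j j' t else 0) := by
          simp only [coupledLcmSum, hB, hT, Finset.mul_sum]
      _ = ∑ j, ∑ t ∈ B, ∑ j', (c j : ℂ) * c j' *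
            (if CoupledAdm (Pw x) m (couplingSet k x m q) t.1 t.2 then T j j' t else 0) :=
          Finset.sum_congr rfl fun j _ => Finset.sum_comm
      _ = ∑ t ∈ B, ∑ j, ∑ j', (c j : ℂ) * c j' *
            (if CoupledAdm (Pw x) m (couplingSet k x m q) t.1 t.2 then T j j' t else 0) :=
          Finset.sum_comm
      _ = ∑ t ∈ B, if CoupledAdm (Pw x) m (couplingSet k x m q) t.1 t.2 then
            ∑ j, ∑ j', (c j : ℂ) * c j' * T j j' t else 0 := by
          refine Finset.sum_congr rfl fun t _ => ?_
          split_ifs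
          · rfl
          · simp
  rw [hrhs, mainSum]
  push_cast
  rw [box_eq_lcmBox, Finset.sum_product, Finset.sum_product]
  refine Finset.sum_congr rfl fun d _ => Finset.sum_congr rfl fun d' _ => ?_
  rw [Finset.sum_product]
  refine Finset.sum_congr rfl fun e _ => Finset.sum_congr rfl fun e' _ => ?_
  simp only
  by_cases hlam : lam c Fd G ε x d e * lam c Fd G ε x d' e' = 0
  · -- both sides vanish
    have hl : (lam c Fd G ε x d e : ℂ) * (lam c Fd G ε x d' e' : ℂ) /
        (Nat.lcm (∏ i, Nat.lcm (d i) (d' i)) (∏ i, Nat.lcm (e i) (e' i)) : ℂ) = 0 := by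
      rw [← Complex.ofReal_mul, hlam, Complex.ofReal_zero, zero_div]
    have hr : ∑ j, ∑ j', (c j : ℂ) * c j' *
        coupledLcmTerm (fun ℓ => Fd ℓ j) (fun ℓ => Fd ℓ j') (fun _ : Fin k => G) (fun _ => G)
          (x : ℝ) (y ε x) (d, d') (e, e') = 0 := by
      rw [← ofReal_lam_mul_lam_div, hl]
    rw [hr, ite_self]
    split_ifs
    · push_cast
      exact hl
    · rfl
  · -- on the support all moduli are squarefree, and the two conditions agree
    have h1 : lam c Fd G ε x d e ≠ 0 := left_ne_zero_of_mul hlam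
    have h2 : lam c Fd G ε x d' e' ≠ 0 := right_ne_zero_of_mul hlam
    have hsq : ∀ i, Squarefree (Nat.lcm (d i) (d' i)) := fun i =>
      squarefree_lcm (squarefree_of_lam_ne_zero h1 i).1 (squarefree_of_lam_ne_zero h2 i).1
    rw [if_congr (adm_iff_coupledAdm (m := m) (q := q) (e := e) (e' := e') hsq) rfl rfl]
    split_ifs
    · push_cast
      exact ofReal_lam_mul_lam_div c Fd G ε x d d' e e'
    · rfl

end Maynard2016

end Literature.NumberTheory.Sieve
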